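import Mathlib
import Summits.NavierStokesRegularity.FluidComputer.AbcClassIIGraphBound

/-!
# Class-II layer of the skew-cut X0 chain, Part P: preparations for the SECTIONS step (A2)
(instab4 g6 — implementation 2 of the skew-cut X0 certifier, cell `ns-blowup`, 2026-08-27)

HONEST FRAMING (human ruling D-0035): nothing here is a claim about Navier–Stokes blow-up.
WHAT THIS IS NOT: not NS evidence. MODEL lane. The two structural inputs that the SECTIONS step
(`HOME/instab4/KERNEL-CHAIN.md` §5 (A2): feeding instab3's
`SkewCutSchurCoercivity.exists_eigenvalue_of_certificate` with the real section matrices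
`[(x + |O|²/R)δ − amat]` in the orbit basis) needs besides reindexing bookkeeping:

* `amat_eq_zero_of_shells` — the band does not skip a sup-norm shell (adjacent orbits lie in adjacent
  shells, `osupNorm_le_of_mem_nbrIdx`): the head ↔ deep blocks of every finer section VANISH (F3);
* `abs_re_pairing_form_le` / `pairing_form_le_real` / `section_form_ge` — the pairing form of `amat`
  on ANY coefficient vector of a section is bounded by `√2` ((F1)+(F2) = `AbcLatticePairingBound`),
  hence the quadratic form of a section matrix dominates `Σ (x + |O_i|²/R) u_i² − √2 Σ u_i²`: the tail
  inequality `hD` (apply to zero-padded block vectors).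

Mathlib + the files named; no new definitions.
-/

noncomputable section

open scoped BigOperators ComplexConjugate InnerProductSpace
open Finset MeasureTheory UnitAddTorus

namespace Summit.NavierStokesRegularity.FluidComputer.AbcClassII

open Literature.Analysis.FunctionSpaces Literature.Analysis.FunctionSpaces.Torus
open Literature.Analysis.FunctionSpaces.EuclideanSpace
open Literature.Analysis.FluidPDE Literature.Analysis.FluidPDE.SteadyLattice
open Literature.Analysis.FluidPDE.ScalarFourier

/-! ## Part P. Preparations for the SECTIONS step (A2): shell separation of the band, the pairing form
## of the first-order matrix on arbitrary real coefficient vectors (instab4 g6) -/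

section SectionsPrep

/-- **Adjacent orbits lie in adjacent sup-norm shells**: `j ∈ nbrIdx i ⇒ |‖O_i‖_∞ − ‖O_j‖_∞| ≤ 1`. -/
theorem osupNorm_le_of_mem_nbrIdx {i j : Idx} (h : j ∈ nbrIdx i) :
    osupNorm i.1 ≤ osupNorm j.1 + 1 ∧ osupNorm j.1 ≤ osupNorm i.1 + 1 := by
  obtain ⟨k, hk, s, hs, hks⟩ := mem_nbrOrbits.mp (mem_nbrIdx.mp h)
  rw [← i.1.supNorm_eq hk, ← j.1.supNorm_eq hks]
  have hb := fun m => AbcLatticeLocality.abs_sub_abcFreq_bounds k hs m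
  constructor
  · refine Finset.sup_le fun m _ => ?_
    have h1 : (k m).natAbs ≤ ((k - s) m).natAbs + 1 := by
      have := (hb m).1
      rw [Int.abs_eq_natAbs, Int.abs_eq_natAbs] at this
      omega
    exact h1.trans (Nat.add_le_add_right (natAbs_le_supNorm (k - s) m) 1)
  · refine Finset.sup_le fun m _ => ?_
    have h1 : ((k - s) m).natAbs ≤ (k m).natAbs + 1 := by
      have := (hb m).2
      rw [Int.abs_eq_natAbs, Int.abs_eq_natAbs] at this
      omega
    exact h1.trans (Nat.add_le_add_right (natAbs_le_supNorm k m) 1)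

/-- **The band does not skip a shell**: `amat i j = 0` when the orbits of `i` and `j` are two or more
sup-norm shells apart (head ↔ deep blocks of every finer section vanish, SKEWCUT-CERT (F3)). -/
theorem amat_eq_zero_of_shells {i j : Idx} (h : osupNorm i.1 + 2 ≤ osupNorm j.1 ∨ osupNorm j.1 + 2 ≤ osupNorm i.1) :
    amat i j = 0 := by
  refine amat_eq_zero_of_not_mem fun hmem => ?_
  have := osupNorm_le_of_mem_nbrIdx hmem
  omega

/-- **The pairing form of the first-order matrix is bounded by `√2`** on every complex coefficient
vector of a section: `|Re Σ_{i,j ∈ cubeIdx n} conj(c_i) amat i j c_j| ≤ √2 Σ_j |c_j|²`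
(the (A4) pairing bound `AbcLatticePairingBound.abs_re_sum_inner_crossForm_le` on the section
combination `Σ_j c_j bfam j`; covers head, shell and tail vectors by zero-padding). -/
theorem abs_re_pairing_form_le (n : ℕ) (c : Idx → ℂ) :
    |(∑ i ∈ cubeIdx n, (starRingEnd ℂ) (c i) * ∑ j ∈ cubeIdx n, ((amat i j : ℝ) : ℂ) * c j).re| ≤
      Real.sqrt 2 * ∑ j ∈ cubeIdx n, ‖c j‖ ^ 2 := by
  classical
  set f : Fam := ∑ j ∈ cubeIdx n, c j • bfam j with hf
  set S := (cube n).filter (fun k => k ≠ 0) with hS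
  have hft : ∀ k : Fin 3 → ℤ, ∑ jj : Fin 3, ((k jj : ℤ) : ℂ) * f k jj = 0 :=
    fun k => kdot_sum_smul_bfam (cubeIdx n) (fun j => j) c k
  have hfS : ∀ k ∉ S, f k = 0 := fun k hk => sectionFam_eq_zero_of_not_mem c hk
  have hpair := AbcLatticePairingBound.abs_re_sum_inner_crossForm_le f S hfS hft
  change |(∑ k ∈ S, (inner ℂ (f k) (crossForm 1 1 1 f k) : ℂ)).re| ≤ Real.sqrt 2 * ∑ k ∈ S, ‖f k‖ ^ 2 at hpair
  have hproj : ∀ k ∈ S, (inner ℂ (f k) (crossForm 1 1 1 f k) : ℂ) =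
      (inner ℂ (f k) (Torus.lerayCoeff k (crossForm 1 1 1 f k)) : ℂ) := by
    intro k hk
    rw [AbcLinearisedPairing.inner_lerayCoeff_of_transversal (Finset.mem_filter.mp hk).2 (hft k)]
  rw [Finset.sum_congr rfl hproj, hS, hf, sum_inner_section_lerayCrossForm n c, sum_norm_sq_section n c] at hpair
  exact hpair

/-- **Real form**: for a real coefficient vector `u` on a section,
`Σ_{i,j ∈ cubeIdx n} u_i amat i j u_j ≤ √2 Σ_j u_j²` — the (F1)+(F2) tail inequality input `hD` of
`SkewCutSchurCoercivity.exists_eigenvalue_of_certificate` for every block (zero-pad `u`). -/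
theorem pairing_form_le_real (n : ℕ) (u : Idx → ℝ) :
    ∑ i ∈ cubeIdx n, u i * ∑ j ∈ cubeIdx n, amat i j * u j ≤ Real.sqrt 2 * ∑ j ∈ cubeIdx n, u j ^ 2 := by
  have h := abs_re_pairing_form_le n (fun i => ((u i : ℝ) : ℂ))
  have e1 : (∑ i ∈ cubeIdx n, (starRingEnd ℂ) (((u i : ℝ) : ℂ)) *
      ∑ j ∈ cubeIdx n, ((amat i j : ℝ) : ℂ) * ((u j : ℝ) : ℂ)).re =
      ∑ i ∈ cubeIdx n, u i * ∑ j ∈ cubeIdx n, amat i j * u j := by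
    have : (∑ i ∈ cubeIdx n, (starRingEnd ℂ) (((u i : ℝ) : ℂ)) *
        ∑ j ∈ cubeIdx n, ((amat i j : ℝ) : ℂ) * ((u j : ℝ) : ℂ)) =
        (((∑ i ∈ cubeIdx n, u i * ∑ j ∈ cubeIdx n, amat i j * u j : ℝ)) : ℂ) := by
      push_cast
      refine Finset.sum_congr rfl fun i _ => ?_
      rw [Complex.conj_ofReal]
    rw [this, Complex.ofReal_re]
  have e2 : ∑ j ∈ cubeIdx n, ‖((u j : ℝ) : ℂ)‖ ^ 2 = ∑ j ∈ cubeIdx n, u j ^ 2 :=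
    Finset.sum_congr rfl fun j _ => by rw [Complex.norm_real, Real.norm_eq_abs, sq_abs]
  rw [e1, e2] at h
  exact (le_abs_self _).trans h

/-- **The quadratic form of a section matrix is tail-coercive**: for a real vector `u` on a section,
`Σ_i (x + |O_i|²/R) u_i² − √2 Σ u_i² ≤ Σ_i u_i Σ_j ((x + |O_j|²/R)δ_ij − amat i j) u_j` — the shape of
hypothesis `hD` of `SkewCutSchurCoercivity.exists_eigenvalue_of_certificate` (zero-pad `u` to a block). -/
theorem section_form_ge (R x : ℝ) (n : ℕ) (u : Idx → ℝ) :
    ∑ i ∈ cubeIdx n, (x + onormSq i.1 / R) * u i ^ 2 - Real.sqrt 2 * ∑ i ∈ cubeIdx n, u i ^ 2 ≤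
      ∑ i ∈ cubeIdx n, u i * ∑ j ∈ cubeIdx n,
        ((if i = j then x + onormSq j.1 / R else 0) - amat i j) * u j := by
  classical
  have e : ∑ i ∈ cubeIdx n, u i * ∑ j ∈ cubeIdx n, ((if i = j then x + onormSq j.1 / R else 0) - amat i j) * u j =
      ∑ i ∈ cubeIdx n, (x + onormSq i.1 / R) * u i ^ 2 -
        ∑ i ∈ cubeIdx n, u i * ∑ j ∈ cubeIdx n, amat i j * u j := by
    rw [← Finset.sum_sub_distrib]
    refine Finset.sum_congr rfl fun i hi => ?_
    have h1 : ∑ j ∈ cubeIdx n, ((if i = j then x + onormSq j.1 / R else 0) - amat i j) * u j =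
        (x + onormSq i.1 / R) * u i - ∑ j ∈ cubeIdx n, amat i j * u j := by
      simp only [sub_mul, Finset.sum_sub_distrib, ite_mul, zero_mul]
      rw [Finset.sum_ite_eq, if_pos hi]
    rw [h1]; ring
  rw [e]
  linarith [pairing_form_le_real n u]

end SectionsPrep

end Summit.NavierStokesRegularity.FluidComputer.AbcClassII

end
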